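import Literature.Computability.QuantumComplexity.LowRankPCA
import HarnessLib

/-!
# Dequantized low-rank matrix inversion / principal component regression (CGLLTW, §4.4:
# Definition 4.9, Problem 4.10, Corollary 4.11) — the thresholded inverse `ρ_{σ,η}`, the error of
# the sketched solution, and even SVT uniformly in `f` on the `f`-free good event

Chia, Gilyén, Li, Lin, Tang, Wang, *Sampling-based sublinear low-rank matrix arithmetic framework
for dequantizing quantum machine learning*, J. ACM 69(5):33 (2022) = arXiv:1910.06151 (held text,
§4.4 "Matrix inversion and principal component regression", p. 26 L62 – p. 27 L58).  The
dequantization of HHL-type matrix inversion "in the regime where the input matrix is low-rank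
instead of sparse" (after Gilyén–Lloyd–Tang 2018 and Chia–Lin–Wang 2018; "Since sparse matrix
inversion is BQP-complete, it is unlikely that one can efficiently dequantize it"):

> **Definition 4.9 (`A⁺_{σ,η}`).** We define `A⁺_{σ,η}` to be any singular value transform of `A`
> satisfying `A⁺_{σ,η} := ρ_{σ,η}^{(SV)}(A)`, `ρ_{σ,η}(λ) = 1/λ` (`λ ≥ σ`), `= 0` (`λ < σ(1−η)`),
> `∈ [0, σ⁻¹]` (otherwise).  [It is `A⁺` for singular vectors with value `≥ σ`, zero for singular
> vectors with value `≤ σ(1−η)`, and a linear interpolation between the two in between.]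
>
> **Problem 4.10.** Given `SQ_φ(A) ∈ ℂ^{m×n}`, `Q(b) ∈ ℂ^m`, with probability `≥ 1−δ`, get
> `SQ_φ(x̂)` such that `‖x̂ − x*‖ ≤ ε‖x*‖`, where `x* := A⁺_{σ,η}b`.
>
> **Corollary 4.11.** For `0 < ε ≲ ‖A‖²/σ²` [sic, as extracted] and `η ≤ 0.99`, we can solve
> (Problem 4.10) in `Õ((‖A‖_F⁶/σ⁶)K³κ¹¹… ε⁻⁶ log³(1/δ))` time […].  However, this algorithm also
> works for larger `ε`; namely, if we only require that `‖x̂ − x*‖ ≤ εσ⁻¹‖b‖` (a "worst-case"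
> error bound), then this algorithm works with runtime smaller by a factor […].
>
> *Proof.* We will solve our problem for `x* = A⁺_{σ,η}b = ρ(A†A)A†b` where
> `ρ(x) = 0` (`x < σ²(1−η)`), `= (x − σ²(1−η))/(ησ⁴)` (`σ²(1−η) ≤ x < σ²`), `= 1/x` (`σ² ≤ x`).
> So, if we can estimate `ρ(A†A)` such that `‖ρ(A†A) − R†\bar ρ(CC†)R‖ ≤ [ε-threshold]`, then as
> desired, `‖A⁺_{σ,η}b − R†\bar ρ(CC†)RA†b‖ ≤ [ε-threshold]·‖A‖‖b‖ ≤ ε‖A⁺_{σ,η}b‖`.  By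
> (thm:evenSing) with `L = 1/(ησ⁴)` and `\bar L = 1/(η²(1−η)²σ⁶)`, we can find such `R` and `C`
> with `r = Õ(…)`, `c = Õ(…)`. […] Next, we would like to further approximate `R†\bar ρ(CC†)RA†b`.
> We will do this by estimating `RA†b` by some vector `u` […] `x̂ := R†\bar ρ(CC†)u` […].

What is formalized (real matrices, the tree's Frobenius-norm SQ toolbox):

* **`ρ_{σ,η}`** on the squared singular values (`rho σ η`, written as
  `min(max(0, (x − σ²(1−η))/(ησ⁴)), 1/max(x, σ²))`, which IS the printed three-case function:
  `rho_of_le`, `rho_of_mem`, `rho_of_ge`), `0 ≤ ρ ≤ 1/σ²`, `ρ(0) = 0`, and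
  **"`L = 1/(ησ⁴)`"** PROVED (`abs_rho_sub_rho_le`, `0 < η ≤ 1`); `\bar ρ = ρ(x)/x` with
  `x\bar ρ(x) = ρ(x)` and its Lipschitz constant PROVED as `L/a + (1/σ²)/a²`, `a = σ²(1−η)`
  (`= 1/(η(1−η)²σ⁶)`, at most the printed `\bar L = 1/(η²(1−η)²σ⁶)`; `abs_rhoBar_sub_rhoBar_le`, via
  the bounded form `abs_div_sub_div_le'` of `LowRankPCA.abs_div_sub_div_le`);
* **the first two displays of the proof, pointwise in the sketch outcome** (`target_sub_sketch_le`):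
  for ANY `R` (`= SA`), `C` (`= RT`), `b`:
  `‖ρ(AᵀA)Aᵀb − Rᵀ\bar ρ(CCᵀ)R Aᵀb‖ ≤ (L‖RᵀR − AᵀA‖_F + ‖R‖_F²·\bar L·‖RRᵀ − CCᵀ‖_F)·‖Aᵀb‖`
  (the even-SVT decomposition `evenSVT_error_le`, Lemma 5.4 `frobNorm_cfc_gram_sub_le` twice,
  `‖Mv‖ ≤ ‖M‖_F‖v‖`);
* **even SVT uniformly in `f` on the good event** (`evenSVT_on_good_event`): on the `f`-free event
  of `LowRankPCA.two_sketch_good_event` the printed four-bullet chain gives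
  `‖Rᵀ\bar f(CCᵀ)R − f(XᵀX)‖_F ≤ Lθ₁ + φ‖X‖_F²\bar Lθ₂` for EVERY admissible
  `(f, \bar f, L, \bar L)` simultaneously — the tree's `even_singular_value_transformation`
  fixed `f` before sampling;
* **Corollary 4.11, first half, in mass form** (`low_rank_inversion`): with two-stage mass
  `> 1 − δ₁ − δ₂ − δ₃`, simultaneously for all `b`, `σ > 0`, `0 < η < 1`:
  `‖ρ_{σ,η}(AᵀA)Aᵀb − x̂₀‖ ≤ (θ₁/(ησ⁴) + φ‖A‖_F²·\bar L·θ₂)·‖Aᵀb‖`, `x̂₀ = Rᵀ\bar ρ(CCᵀ)RAᵀb`.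

Scope, stated precisely.  (i) `x* := ρ(AᵀA)Aᵀb` is taken as the definition of the target (the
proof's first line "`x* = A⁺_{σ,η}b = ρ(A†A)A†b`"; Definition 4.9 allows any interpolation in the
window, the proof fixes the linear one).  (ii) The printed RELATIVE error `≤ ε‖x*‖` rests on
`‖A‖⁻¹‖b‖ ≤ ‖x*‖` (used twice on p. 27), which holds when `b` lies in the span of the left singular
vectors of `A` with singular value `≥ σ` and fails otherwise (for `b ⊥ range A`, `x* = x̂₀ = 0`);
we prove the absolute bound, of which the paper's own "worst-case" variant `≤ εσ⁻¹‖b‖` is the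
unconditional reading, and do not assert the relative one.  (iii) Not formalized: the second half
of the proof (replacing `RA†b` by inner-product estimates `u`, (lemma:xAy), (lem:evenSingBounds))
and the oversampling factor of `SQ_φ(x̂)`; running times.  Real matrices; no named facts are
introduced; everything stated is proved.

## References
* [ChiaEtAl2022] N.-H. Chia, A. Gilyén, T. Li, H.-H. Lin, E. Tang, C. Wang, J. ACM 69(5) (2022)
  33:1–33:72, doi:10.1145/3549524 (arXiv:1910.06151, held as `paper:arxiv-1910.06151`: §4.4,
  Definition 4.9, Problem 4.10, Corollary 4.11 and its proof, pp. 26–27 of the held text).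
* [GilyenLloydTang2018] A. Gilyén, S. Lloyd, E. Tang, *Quantum-inspired low-rank stochastic
  regression with logarithmic dependence on the dimension*, arXiv:1811.04909 — the dequantized
  low-rank matrix inversion this corollary re-derives ("[gilyen2018QInsLowRankHHL]").
* [HarrowHassidimLloyd2009] A. W. Harrow, A. Hassidim, S. Lloyd, *Quantum algorithm for linear
  systems of equations*, Phys. Rev. Lett. 103, 150502 (2009) — the quantum algorithm whose
  low-rank regime is dequantized.
-/

noncomputable section

open scoped Matrix

namespace Literature.Computability.QuantumComplexity

namespace SampleQuery

namespace LowRankInversion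

open Finset LowRankPCA

variable {m n s c : ℕ}

/-! ### The thresholded inverse `ρ_{σ,η}` of the squared singular values and `\bar ρ = ρ(x)/x` -/

/-- CGLLTW's thresholded inverse on the squared singular values: `ρ(x) = 0` for
`x < σ²(1−η)`, `ρ(x) = (x − σ²(1−η))/(ησ⁴)` for `σ²(1−η) ≤ x < σ²`, `ρ(x) = 1/x` for `x ≥ σ²`
(written as the minimum of the ramp and of `1/max(x, σ²)`, which is the same function — see
`rho_of_le`, `rho_of_mem`, `rho_of_ge`). [cite: ChiaEtAl2022, §4.4 proof of Cor. 4.11 (the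
displayed three-case definition of `ρ`) and Definition 4.9 (`ρ_{σ,η}`)] -/
def rho (σ η x : ℝ) : ℝ := min (max 0 ((x - σ ^ 2 * (1 - η)) / (η * σ ^ 4))) (1 / max x (σ ^ 2))

/-- `\bar ρ(x) = ρ(x)/x` (with `0/0 = 0`). [cite: ChiaEtAl2022, §4.4 proof of Cor. 4.11
(`R†\bar ρ(CC†)R`) and §3.1 Theorem "evenSing" (`\bar f(x) = (f(x) − f(0))/x`)] -/
def rhoBar (σ η x : ℝ) : ℝ := rho σ η x / x

section rho

variable {σ η : ℝ}

/-- The ramp `max(0, (x − σ²(1−η))/(ησ⁴))` is `1/(ησ⁴)`-Lipschitz. [folklore] (private plumbing) -/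
private theorem ramp_lipschitz (hσ : 0 < σ) (hη : 0 < η) (x y : ℝ) :
    |max 0 ((x - σ ^ 2 * (1 - η)) / (η * σ ^ 4)) - max 0 ((y - σ ^ 2 * (1 - η)) / (η * σ ^ 4))| ≤
      (1 / (η * σ ^ 4)) * |x - y| := by
  have hk : 0 < η * σ ^ 4 := by positivity
  rw [max_comm (0 : ℝ) _, max_comm (0 : ℝ) _]
  refine (abs_max_sub_max_le_abs ((x - σ ^ 2 * (1 - η)) / (η * σ ^ 4))
    ((y - σ ^ 2 * (1 - η)) / (η * σ ^ 4)) 0).trans (le_of_eq ?_)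
  rw [← sub_div, abs_div, abs_of_pos hk, show x - σ ^ 2 * (1 - η) - (y - σ ^ 2 * (1 - η)) = x - y
    by ring]
  ring

/-- `1/max(x, σ²)` is `1/σ⁴`-Lipschitz. [folklore] (private plumbing) -/
private theorem invmax_lipschitz (hσ : 0 < σ) (x y : ℝ) :
    |1 / max x (σ ^ 2) - 1 / max y (σ ^ 2)| ≤ (1 / σ ^ 4) * |x - y| := by
  have hσ2 : 0 < σ ^ 2 := by positivity
  have hx : σ ^ 2 ≤ max x (σ ^ 2) := le_max_right _ _
  have hy : σ ^ 2 ≤ max y (σ ^ 2) := le_max_right _ _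
  have hx0 : 0 < max x (σ ^ 2) := hσ2.trans_le hx
  have hy0 : 0 < max y (σ ^ 2) := hσ2.trans_le hy
  rw [div_sub_div _ _ hx0.ne' hy0.ne', one_mul, mul_one, abs_div, abs_of_pos (mul_pos hx0 hy0),
    div_le_iff₀ (mul_pos hx0 hy0)]
  have h1 : |max y (σ ^ 2) - max x (σ ^ 2)| ≤ |x - y| := by
    rw [abs_sub_comm]; exact abs_max_sub_max_le_abs x y (σ ^ 2)
  calc |max y (σ ^ 2) - max x (σ ^ 2)| ≤ |x - y| * 1 := by rw [mul_one]; exact h1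
    _ ≤ |x - y| * ((1 / σ ^ 4) * (max x (σ ^ 2) * max y (σ ^ 2))) := by
        refine mul_le_mul_of_nonneg_left ?_ (abs_nonneg _)
        rw [one_div, le_inv_mul_iff₀ (by positivity), mul_one, show σ ^ 4 = σ ^ 2 * σ ^ 2 by ring]
        exact mul_le_mul hx hy hσ2.le hx0.le
    _ = 1 / σ ^ 4 * |x - y| * (max x (σ ^ 2) * max y (σ ^ 2)) := by ring

/-- "`ρ(x) = 0` for `x < σ²(1−η)`" (indeed for `x ≤ σ²(1−η)`). [cite: ChiaEtAl2022, §4.4 proof of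
Cor. 4.11] -/
theorem rho_of_le (hσ : 0 < σ) (hη : 0 < η) {x : ℝ} (hx : x ≤ σ ^ 2 * (1 - η)) : rho σ η x = 0 := by
  unfold rho
  have h1 : max 0 ((x - σ ^ 2 * (1 - η)) / (η * σ ^ 4)) = 0 :=
    max_eq_left (div_nonpos_of_nonpos_of_nonneg (by linarith) (by positivity))
  rw [h1, min_eq_left]
  exact div_nonneg zero_le_one ((sq_nonneg σ).trans (le_max_right _ _) |>.trans' le_rfl)

/-- "`ρ(x) = 1/x` for `σ² ≤ x`". [cite: ChiaEtAl2022, §4.4 proof of Cor. 4.11] -/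
theorem rho_of_ge (hσ : 0 < σ) (hη0 : 0 < η) {x : ℝ} (hx : σ ^ 2 ≤ x) :
    rho σ η x = 1 / x := by
  unfold rho
  have hσ2 : 0 < σ ^ 2 := by positivity
  have hx0 : 0 < x := hσ2.trans_le hx
  rw [max_eq_left hx, min_eq_right]
  refine le_max_of_le_right ?_
  rw [div_le_div_iff₀ hx0 (by positivity), one_mul]
  -- `η σ⁴ ≤ (x − σ²(1−η)) x` since `x ≥ σ²`
  have h1 : σ ^ 2 * η ≤ x - σ ^ 2 * (1 - η) := by nlinarith
  calc η * σ ^ 4 = σ ^ 2 * η * σ ^ 2 := by ring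
    _ ≤ (x - σ ^ 2 * (1 - η)) * x := mul_le_mul h1 hx hσ2.le (by nlinarith)

/-- "`ρ(x) = (x − σ²(1−η))/(ησ⁴)` for `σ²(1−η) ≤ x < σ²`" (indeed for `x ≤ σ²`). [cite:
ChiaEtAl2022, §4.4 proof of Cor. 4.11] -/
theorem rho_of_mem (hσ : 0 < σ) (hη : 0 < η) {x : ℝ} (h1 : σ ^ 2 * (1 - η) ≤ x) (h2 : x ≤ σ ^ 2) :
    rho σ η x = (x - σ ^ 2 * (1 - η)) / (η * σ ^ 4) := by
  unfold rho
  have hk : 0 < η * σ ^ 4 := by positivity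
  rw [max_eq_right (div_nonneg (by linarith) hk.le), max_eq_right h2, min_eq_left]
  rw [div_le_div_iff₀ hk (by positivity), one_mul]
  nlinarith

/-- `0 ≤ ρ`. [cite: ChiaEtAl2022, Definition 4.9 (`ρ_{σ,η}(λ) ∈ [0, σ⁻¹]` between the
thresholds)] -/
theorem rho_nonneg (σ η x : ℝ) : 0 ≤ rho σ η x :=
  le_min (le_max_left _ _) (div_nonneg zero_le_one ((sq_nonneg σ).trans (le_max_right _ _)))

/-- `ρ ≤ 1/σ²` (on the squared singular values; Definition 4.9's `σ⁻¹` on the singular values).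
[cite: ChiaEtAl2022, Definition 4.9] -/
theorem rho_le (hσ : 0 < σ) (x : ℝ) : rho σ η x ≤ 1 / σ ^ 2 :=
  (min_le_right _ _).trans (one_div_le_one_div_of_le (by positivity) (le_max_right _ _))

/-- `|ρ| ≤ 1/σ²`. [cite: ChiaEtAl2022, Definition 4.9] -/
theorem abs_rho_le (hσ : 0 < σ) (x : ℝ) : |rho σ η x| ≤ 1 / σ ^ 2 := by
  rw [abs_of_nonneg (rho_nonneg σ η x)]; exact rho_le hσ x

/-- `ρ(0) = 0` (so `\bar ρ(x) = ρ(x)/x` is the `\bar f` of the even SVT). [cite: ChiaEtAl2022, §4.4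
proof of Cor. 4.11] -/
theorem rho_zero (hσ : 0 < σ) (hη0 : 0 < η) (hη : η ≤ 1) : rho σ η 0 = 0 :=
  rho_of_le hσ hη0 (by nlinarith [sq_nonneg σ])

/-- **`ρ` is `1/(ησ⁴)`-Lipschitz** ("by (thm:evenSing) with `L = 1/(ησ⁴)`"), for `0 < η ≤ 1`.
[cite: ChiaEtAl2022, §4.4 proof of Cor. 4.11] -/
theorem abs_rho_sub_rho_le (hσ : 0 < σ) (hη0 : 0 < η) (hη : η ≤ 1) (x y : ℝ) :
    |rho σ η x - rho σ η y| ≤ (1 / (η * σ ^ 4)) * |x - y| := by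
  unfold rho
  refine (abs_min_sub_min_le_max _ _ _ _).trans (max_le (ramp_lipschitz hσ hη0 x y) ?_)
  refine (invmax_lipschitz hσ x y).trans (mul_le_mul_of_nonneg_right ?_ (abs_nonneg _))
  exact one_div_le_one_div_of_le (by positivity) (by nlinarith [pow_pos hσ 4])

/-- `x · \bar ρ(x) = ρ(x)` for every real `x`. [cite: ChiaEtAl2022, §4.4 proof of Cor. 4.11] -/
theorem mul_rhoBar (hσ : 0 < σ) (hη0 : 0 < η) (hη : η ≤ 1) (x : ℝ) :
    x * rhoBar σ η x = rho σ η x := by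
  unfold rhoBar
  by_cases hx : x = 0
  · rw [hx, rho_zero hσ hη0 hη]; simp
  · exact mul_div_cancel₀ _ hx

end rho

/-- **Lipschitz constant of `g(x) = f(x)/x`, bounded version**: if `f` vanishes on `(−∞, a]`
(`a > 0`), `|f| ≤ B` and `f` is `L`-Lipschitz, then `|f(x)/x − f(y)/y| ≤ (L/a + B/a²)|x − y|` for
all real `x, y`. (`LowRankPCA.abs_div_sub_div_le` is the case `B = 1`.) [cite: ChiaEtAl2022, §4.4
proof of Cor. 4.11 ("`\bar L = 1/(η²(1−η)²σ⁶)`", the constant this lemma makes explicit)] -/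
theorem abs_div_sub_div_le' {f : ℝ → ℝ} {L B a : ℝ} (ha : 0 < a) (hL : 0 ≤ L) (hB : 0 ≤ B)
    (hf0 : ∀ x, x ≤ a → f x = 0) (hf1 : ∀ x, |f x| ≤ B)
    (hfL : ∀ x y, |f x - f y| ≤ L * |x - y|) (x y : ℝ) :
    |f x / x - f y / y| ≤ (L / a + B / a ^ 2) * |x - y| := by
  have hK : 0 ≤ L / a + B / a ^ 2 := by positivity
  have side : ∀ {x y : ℝ}, x ≤ a → a < y →
      |f x / x - f y / y| ≤ (L / a + B / a ^ 2) * |x - y| := by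
    intro x y hxa hay
    have hy0 : 0 < y := ha.trans hay
    rw [hf0 x hxa, zero_div, zero_sub, abs_neg, abs_div, abs_of_pos hy0]
    have h1 : |f y| ≤ L * |x - y| := by
      have := hfL y a
      rw [hf0 a le_rfl, sub_zero] at this
      refine this.trans (mul_le_mul_of_nonneg_left ?_ hL)
      rw [abs_of_pos (by linarith), abs_sub_comm, abs_of_pos (by linarith)]; linarith
    calc |f y| / y ≤ L * |x - y| / a := by
          rw [div_le_div_iff₀ hy0 ha]
          calc |f y| * a ≤ L * |x - y| * a := mul_le_mul_of_nonneg_right h1 ha.le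
            _ ≤ L * |x - y| * y := mul_le_mul_of_nonneg_left hay.le (by positivity)
      _ = (L / a) * |x - y| := by ring
      _ ≤ (L / a + B / a ^ 2) * |x - y| :=
          mul_le_mul_of_nonneg_right (le_add_of_nonneg_right (by positivity)) (abs_nonneg _)
  rcases le_or_gt x a with hxa | hax
  · rcases le_or_gt y a with hya | hay
    · rw [hf0 x hxa, hf0 y hya]; simpa using mul_nonneg hK (abs_nonneg (x - y))
    · exact side hxa hay
  · rcases le_or_gt y a with hya | hay
    · rw [abs_sub_comm, abs_sub_comm x y]; exact side hya hax
    · have hx0 : 0 < x := ha.trans hax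
      have hy0 : 0 < y := ha.trans hay
      have hxy : f x / x - f y / y = ((f x - f y) * y + f y * (y - x)) / (x * y) := by
        field_simp; ring
      rw [hxy, abs_div, abs_of_pos (mul_pos hx0 hy0), div_le_iff₀ (mul_pos hx0 hy0)]
      calc |(f x - f y) * y + f y * (y - x)|
          ≤ |(f x - f y) * y| + |f y * (y - x)| := abs_add_le _ _
        _ = |f x - f y| * y + |f y| * |x - y| := by
            rw [abs_mul, abs_mul, abs_of_pos hy0, abs_sub_comm y x]
        _ ≤ L * |x - y| * y + B * |x - y| :=
            add_le_add (mul_le_mul_of_nonneg_right (hfL x y) hy0.le)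
              (mul_le_mul_of_nonneg_right (hf1 y) (abs_nonneg _))
        _ ≤ L * |x - y| * y * (x / a) + B * |x - y| * (x * y / a ^ 2) := by
            have hxa' : 1 ≤ x / a := (one_le_div ha).mpr hax.le
            have hxya : 1 ≤ x * y / a ^ 2 := by
              rw [one_le_div (by positivity), sq]
              exact mul_le_mul hax.le hay.le ha.le hx0.le
            exact add_le_add (le_mul_of_one_le_right (by positivity) hxa')
              (le_mul_of_one_le_right (by positivity) hxya)
        _ = (L / a + B / a ^ 2) * |x - y| * (x * y) := by
            field_simp

/-- The Lipschitz constant of `\bar ρ`: `|\bar ρ(x) − \bar ρ(y)| ≤ (L/a + (1/σ²)/a²)|x − y|` with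
`L = 1/(ησ⁴)`, `a = σ²(1−η)` (`0 < η < 1`) — i.e. `1/(η(1−η)σ⁶) + 1/((1−η)²σ⁶) = 1/(η(1−η)²σ⁶)`,
at most the paper's `\bar L = 1/(η²(1−η)²σ⁶)`. [cite: ChiaEtAl2022, §4.4 proof of Cor. 4.11
("`\bar L = 1/(η²(1−η)²σ⁶)`")] -/
theorem abs_rhoBar_sub_rhoBar_le {σ η : ℝ} (hσ : 0 < σ) (hη0 : 0 < η) (hη : η < 1) (x y : ℝ) :
    |rhoBar σ η x - rhoBar σ η y| ≤
      ((1 / (η * σ ^ 4)) / (σ ^ 2 * (1 - η)) + (1 / σ ^ 2) / (σ ^ 2 * (1 - η)) ^ 2) * |x - y| :=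
  abs_div_sub_div_le' (f := rho σ η) (by nlinarith [pow_pos hσ 2]) (by positivity) (by positivity)
    (fun z hz => rho_of_le hσ hη0 hz) (abs_rho_le hσ) (abs_rho_sub_rho_le hσ hη0 hη.le) x y

/-! ### `x* = ρ(AᵀA)Aᵀb` versus the sketched `Rᵀ\bar ρ(CCᵀ)R Aᵀb` -/

/-- `‖M − N‖_F = ‖N − M‖_F`. [folklore] (private plumbing) -/
private theorem frobSq_sub_comm {k l : ℕ} (M N : Matrix (Fin k) (Fin l) ℝ) :
    frobSq (M - N) = frobSq (N - M) := by
  simp only [frobSq_eq_sum_sq, Matrix.sub_apply]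
  exact Finset.sum_congr rfl fun i _ => Finset.sum_congr rfl fun j _ => by ring

/-- `‖Mv‖² ≤ ‖M‖_F²‖v‖²` (Cauchy–Schwarz row by row). [folklore] -/
private theorem normSq_mulVec_le {k l : ℕ} (M : Matrix (Fin k) (Fin l) ℝ) (v : Fin l → ℝ) :
    normSq (M *ᵥ v) ≤ frobSq M * normSq v := by
  simp only [normSq, frobSq_eq_sum_sq, Matrix.mulVec, dotProduct]
  rw [Finset.sum_mul]
  exact Finset.sum_le_sum fun i _ => Finset.sum_mul_sq_le_sq_mul_sq _ _ _

/-- `‖(M − N)v‖ ≤ ‖M − N‖_F ‖v‖`, square-root form. [folklore] -/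
private theorem sqrt_normSq_sub_mulVec_le {k l : ℕ} (M N : Matrix (Fin k) (Fin l) ℝ)
    (v : Fin l → ℝ) :
    Real.sqrt (normSq (M *ᵥ v - N *ᵥ v)) ≤
      Real.sqrt (frobSq (M - N)) * Real.sqrt (normSq v) := by
  rw [← Matrix.sub_mulVec, ← Real.sqrt_mul (frobSq_nonneg _)]
  exact Real.sqrt_le_sqrt (normSq_mulVec_le _ _)

/-- **The error of the sketched thresholded pseudoinverse, pointwise in the sketch outcome.**
For real `A` (`m×n`), `b ∈ ℝ^m`, any `R` (`s×n`, `= SA`) and `C` (`s×c`, `= RT`), `0 < σ`,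
`0 < η < 1`: with `x* = ρ(AᵀA)Aᵀb` (the paper's `A⁺_{σ,η}b`) and the sketched
`x̂₀ = Rᵀ\bar ρ(CCᵀ)R Aᵀb`,
`‖x* − x̂₀‖ ≤ ((1/(ησ⁴))‖RᵀR − AᵀA‖_F + ‖R‖_F²(L/a + (1/σ²)/a²)‖RRᵀ − CCᵀ‖_F)·‖Aᵀb‖`
(`L = 1/(ησ⁴)`, `a = σ²(1−η)`) — "if we can estimate `ρ(A†A)` such that
`‖ρ(A†A) − R†\bar ρ(CC†)R‖ ≤ …`, then as desired `‖A⁺_{σ,η}b − R†\bar ρ(CC†)RA†b‖ ≤ … ‖b‖`": the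
even-SVT decomposition (`evenSVT_error_le`), Lemma 5.4 (`frobNorm_cfc_gram_sub_le`) for `ρ` and
`\bar ρ`, and `‖Mv‖ ≤ ‖M‖_F‖v‖`.  The further bound `‖Aᵀb‖ ≤ ‖A‖_F‖b‖` is `normSq_mulVec_le`; the
printed RELATIVE form `≤ ε‖x*‖` additionally uses `‖A‖⁻¹‖b‖ ≤ ‖x*‖`, which holds when `b` lies in
the span of the left singular vectors with `σ_i ≥ σ` but not for every `b` (for `b ⊥ range A`,
`x* = x̂₀ = 0`), so it is not asserted here; the paper's "worst-case" variant
`‖x̂ − x*‖ ≤ εσ⁻¹‖b‖` is the unconditional reading. [cite: ChiaEtAl2022, §4.4 Problem 4.10,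
Cor. 4.11 and its proof (first two displays)] -/
theorem target_sub_sketch_le (A : Matrix (Fin m) (Fin n) ℝ) (b : Fin m → ℝ)
    (R : Matrix (Fin s) (Fin n) ℝ) (C : Matrix (Fin s) (Fin c) ℝ) {σ η : ℝ} (hσ : 0 < σ)
    (hη0 : 0 < η) (hη : η < 1) :
    Real.sqrt (normSq (cfc (rho σ η) (Aᵀ * A) *ᵥ (Aᵀ *ᵥ b) -
        (Rᵀ * cfc (rhoBar σ η) (C * Cᵀ) * R) *ᵥ (Aᵀ *ᵥ b))) ≤
      ((1 / (η * σ ^ 4)) * Real.sqrt (frobSq (Rᵀ * R - Aᵀ * A)) +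
        frobSq R * (((1 / (η * σ ^ 4)) / (σ ^ 2 * (1 - η)) + (1 / σ ^ 2) / (σ ^ 2 * (1 - η)) ^ 2) *
          Real.sqrt (frobSq (R * Rᵀ - C * Cᵀ)))) * Real.sqrt (normSq (Aᵀ *ᵥ b)) := by
  refine (sqrt_normSq_sub_mulVec_le _ _ _).trans
    (mul_le_mul_of_nonneg_right ?_ (Real.sqrt_nonneg _))
  rw [frobSq_sub_comm]
  have hdec := evenSVT_error_le R C A (rho σ η) (rhoBar σ η) (fun x _ => mul_rhoBar hσ hη0 hη.le x)
  refine hdec.trans (add_le_add ?_ (mul_le_mul_of_nonneg_left ?_ (frobSq_nonneg R)))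
  · exact frobNorm_cfc_gram_sub_le R A (rho σ η) (by positivity)
      (fun x y _ _ => abs_rho_sub_rho_le hσ hη0 hη.le x y)
  · have ha : 0 < σ ^ 2 * (1 - η) := by nlinarith [pow_pos hσ 2]
    have h := frobNorm_cfc_gram_sub_le Rᵀ Cᵀ (rhoBar σ η)
      (L := (1 / (η * σ ^ 4)) / (σ ^ 2 * (1 - η)) + (1 / σ ^ 2) / (σ ^ 2 * (1 - η)) ^ 2)
      (add_nonneg (div_nonneg (by positivity) ha.le) (by positivity))
      (fun x y _ _ => abs_rhoBar_sub_rhoBar_le hσ hη0 hη x y)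
    simpa only [Matrix.transpose_transpose] using h

/-! ### Even SVT, uniformly in `f`, on the `f`-free good event; Corollary 4.11 in mass form -/

/-- **Even SVT for every `f` at once on the good event** (deterministic): if the sketch outcome
satisfies `‖RᵀR − XᵀX‖_F < θ₁`, `‖RRᵀ − CCᵀ‖_F < θ₂`, `‖R‖_F² ≤ φ‖X‖_F²`, then for EVERY pair
`f, \bar f` with `|f x − f y| ≤ L|x − y|`, `|\bar f x − \bar f y| ≤ \bar L|x − y|` (`x, y ≥ 0`) and
`x\bar f(x) = f(x)` (`x ≥ 0`): `‖Rᵀ\bar f(CCᵀ)R − f(XᵀX)‖_F ≤ Lθ₁ + φ‖X‖_F²·\bar L·θ₂` — the four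
bullets of the printed proof, with the probability split off into
`LowRankPCA.two_sketch_good_event`. [cite: ChiaEtAl2022, §5.3 proof of Theorem "evenSing" (the
four bullets and "Using the above points, we can conclude")] -/
theorem evenSVT_on_good_event (X : Matrix (Fin m) (Fin n) ℝ) {p : Fin m → ℝ} {q : Fin n → ℝ}
    (ω : Fin s → Fin m) (τ : Fin c → Fin n) {θ₁ θ₂ φ : ℝ}
    (h₁ : Real.sqrt (frobSq ((sketch p ω * X)ᵀ * (sketch p ω * X) - Xᵀ * X)) < θ₁)
    (h₂ : Real.sqrt (frobSq ((sketch p ω * X) * (sketch p ω * X)ᵀ -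
        (sketch q τ * (sketch p ω * X)ᵀ)ᵀ * (sketch q τ * (sketch p ω * X)ᵀ))) < θ₂)
    (h₃ : frobSq (sketch p ω * X) ≤ φ * frobSq X)
    (f fbar : ℝ → ℝ) {L Lbar : ℝ} (hL0 : 0 ≤ L)
    (hL : ∀ x y : ℝ, 0 ≤ x → 0 ≤ y → |f x - f y| ≤ L * |x - y|) (hLb0 : 0 ≤ Lbar)
    (hLb : ∀ x y : ℝ, 0 ≤ x → 0 ≤ y → |fbar x - fbar y| ≤ Lbar * |x - y|)
    (hff : ∀ x : ℝ, 0 ≤ x → x * fbar x = f x) :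
    Real.sqrt (frobSq ((sketch p ω * X)ᵀ *
        cfc fbar ((sketch q τ * (sketch p ω * X)ᵀ)ᵀ * (sketch q τ * (sketch p ω * X)ᵀ)) *
        (sketch p ω * X) - cfc f (Xᵀ * X))) ≤ L * θ₁ + φ * frobSq X * (Lbar * θ₂) := by
  set R := sketch p ω * X with hR
  set B := sketch q τ * Rᵀ with hB
  have hdec := evenSVT_error_le R Bᵀ X f fbar hff
  simp only [Matrix.transpose_transpose] at hdec
  have h54₁ : Real.sqrt (frobSq (cfc f (Rᵀ * R) - cfc f (Xᵀ * X))) ≤ L * θ₁ :=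
    (frobNorm_cfc_gram_sub_le R X f hL0 hL).trans (mul_le_mul_of_nonneg_left h₁.le hL0)
  have h54₂ : Real.sqrt (frobSq (cfc fbar (R * Rᵀ) - cfc fbar (Bᵀ * B))) ≤ Lbar * θ₂ := by
    have h := frobNorm_cfc_gram_sub_le Rᵀ B fbar hLb0 hLb
    simp only [Matrix.transpose_transpose] at h
    exact h.trans (mul_le_mul_of_nonneg_left h₂.le hLb0)
  calc _ ≤ _ := hdec
    _ ≤ L * θ₁ + frobSq R * (Lbar * θ₂) :=
        add_le_add h54₁ (mul_le_mul_of_nonneg_left h54₂ (frobSq_nonneg R))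
    _ ≤ L * θ₁ + φ * frobSq X * (Lbar * θ₂) := by
        have : 0 ≤ Lbar * θ₂ := mul_nonneg hLb0 ((Real.sqrt_nonneg _).trans h₂.le)
        nlinarith

variable {φ : ℝ} {A : Matrix (Fin m) (Fin n) ℝ}

/-- Two-stage masses are monotone in the event (non-negative weights). [folklore] (private
plumbing, as in `LowRankPCA`) -/
private theorem twoStage_mass_mono' {p : Fin m → ℝ} {q : (Fin s → Fin m) → Fin n → ℝ}
    (hp : ∀ k, 0 ≤ p k) (hq : ∀ ω k, 0 ≤ q ω k)
    {G P : (Fin s → Fin m) → (Fin c → Fin n) → Prop} [∀ ω, DecidablePred (G ω)]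
    [∀ ω, DecidablePred (P ω)] (hGP : ∀ ω τ, G ω τ → P ω τ) :
    ∑ ω : Fin s → Fin m, iidWeight p ω * ∑ τ ∈ univ.filter (G ω), iidWeight (q ω) τ ≤
      ∑ ω : Fin s → Fin m, iidWeight p ω * ∑ τ ∈ univ.filter (P ω), iidWeight (q ω) τ :=
  sum_le_sum fun ω _ => mul_le_mul_of_nonneg_left
    (sum_le_sum_of_subset_of_nonneg (fun τ hτ => by
        simp only [mem_filter, mem_univ, true_and] at hτ ⊢; exact hGP ω τ hτ)
      fun τ _ _ => iidWeight_nonneg (hq ω) τ)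
    (iidWeight_nonneg hp ω)

open Classical in
/-- **Corollary 4.11 (low-rank matrix inversion / principal component regression from `SQ_φ(A)`;
Frobenius form, explicit constants), first half of the printed proof in mass form.**  With
`SQ_φ(A)` (`A ≠ 0`), `s, c ≥ 1`, `δ₁, δ₂, δ₃ > 0`, `s ≥ 2φ² ln(1/δ₃)`,
`θ₁ = √(8φ² log(2/δ₁)/s)‖A‖_F²`, `θ₂ = φ√(32φ² log(2/δ₂)/c)‖A‖_F²`: with two-stage mass
`> 1 − δ₁ − δ₂ − δ₃`, SIMULTANEOUSLY for every `b ∈ ℝ^m`, `σ > 0` and `0 < η < 1`, the sketched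
`x̂₀ = Rᵀ\bar ρ_{σ,η}(CCᵀ)R Aᵀb` satisfies
`‖ρ_{σ,η}(AᵀA)Aᵀb − x̂₀‖ ≤ (θ₁/(ησ⁴) + φ‖A‖_F²·(L/a + (1/σ²)/a²)·θ₂)·‖Aᵀb‖` (`L = 1/(ησ⁴)`,
`a = σ²(1−η)`).  (The second half of the printed proof — replacing `RA†b` by inner-product
estimates `u` and the oversampling factor of `SQ_φ(x̂)` — is not formalized here.)
[cite: ChiaEtAl2022, §4.4 Cor. 4.11 and its proof ("By (thm:evenSing) with `L = 1/(ησ⁴)` and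
`\bar L = 1/(η²(1−η)²σ⁶)`, we can find such `R` and `C`")] -/
theorem low_rank_inversion (W : MatrixOversamplingWitness φ A) (hA : A ≠ 0)
    (hs : 0 < s) (hc : 0 < c) {δ₁ δ₂ δ₃ : ℝ} (hδ₁ : 0 < δ₁) (hδ₂ : 0 < δ₂) (hδ₃ : 0 < δ₃)
    (hsδ : 2 * φ ^ 2 * Real.log (1 / δ₃) ≤ s) :
    1 - δ₁ - δ₂ - δ₃ <
      ∑ ω : Fin s → Fin m, iidWeight (rowDist W.tilde) ω *
        ∑ τ ∈ univ.filter (fun τ : Fin c → Fin n =>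
          ∀ (b : Fin m → ℝ) (σ η : ℝ), 0 < σ → 0 < η → η < 1 →
            Real.sqrt (normSq (cfc (rho σ η) (Aᵀ * A) *ᵥ (Aᵀ *ᵥ b) -
              ((sketch (rowDist W.tilde) ω * A)ᵀ *
                cfc (rhoBar σ η) ((sketch (rowDist (sketch (rowDist W.tilde) ω * W.tilde)ᵀ) τ *
                    (sketch (rowDist W.tilde) ω * A)ᵀ)ᵀ *
                  (sketch (rowDist (sketch (rowDist W.tilde) ω * W.tilde)ᵀ) τ *
                    (sketch (rowDist W.tilde) ω * A)ᵀ)) *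
                (sketch (rowDist W.tilde) ω * A)) *ᵥ (Aᵀ *ᵥ b))) ≤
            ((1 / (η * σ ^ 4)) * (Real.sqrt (8 * φ ^ 2 * Real.log (2 / δ₁) / s) * frobSq A) +
              φ * frobSq A *
                ((((1 / (η * σ ^ 4)) / (σ ^ 2 * (1 - η)) + (1 / σ ^ 2) / (σ ^ 2 * (1 - η)) ^ 2)) *
                  (φ * Real.sqrt (32 * φ ^ 2 * Real.log (2 / δ₂) / c) * frobSq A))) *
              Real.sqrt (normSq (Aᵀ *ᵥ b))),
          iidWeight (rowDist (sketch (rowDist W.tilde) ω * W.tilde)ᵀ) τ := by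
  refine lt_of_lt_of_le (two_sketch_good_event W hA hs hc hδ₁ hδ₂ hδ₃ hsδ) ?_
  refine twoStage_mass_mono' (W.isOversampledDist_rowDist hA).nonneg
    (fun ω k => div_nonneg (normSq_nonneg _) (frobSq_nonneg _)) fun ω τ hG => ?_
  intro b σ η hσ hη0 hη
  set R := sketch (rowDist W.tilde) ω * A with hR
  set B := sketch (rowDist (sketch (rowDist W.tilde) ω * W.tilde)ᵀ) τ * Rᵀ with hB
  have ha : 0 < σ ^ 2 * (1 - η) := by nlinarith [pow_pos hσ 2]
  have hLb : 0 ≤ (1 / (η * σ ^ 4)) / (σ ^ 2 * (1 - η)) + (1 / σ ^ 2) / (σ ^ 2 * (1 - η)) ^ 2 :=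
    add_nonneg (div_nonneg (by positivity) ha.le) (by positivity)
  refine (sqrt_normSq_sub_mulVec_le _ _ _).trans
    (mul_le_mul_of_nonneg_right ?_ (Real.sqrt_nonneg _))
  rw [frobSq_sub_comm]
  exact evenSVT_on_good_event A ω τ hG.1 hG.2.1 hG.2.2 (rho σ η) (rhoBar σ η) (by positivity)
    (fun x y _ _ => abs_rho_sub_rho_le hσ hη0 hη.le x y) hLb
    (fun x y _ _ => abs_rhoBar_sub_rhoBar_le hσ hη0 hη x y) (fun x _ => mul_rhoBar hσ hη0 hη.le x)

end LowRankInversion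

end SampleQuery

end Literature.Computability.QuantumComplexity
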